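import Summits.BirchSwinnertonDyer.BirchSwinnertonDyer.Theorems.EisensteinPrimesTwoVariableDescentPrelims
import Summits.BirchSwinnertonDyer.BirchSwinnertonDyer.Theorems.EisensteinPrimesTwoVariablePseudoNull
import Summits.BirchSwinnertonDyer.BirchSwinnertonDyer.Theorems.EisensteinPrimesTwoVariableSnake
import Mathlib.LinearAlgebra.TensorProduct.RightExactness
import HarnessLib

/-!
# The descent lemma `Λ₂ = ℤ_p⟦S⟧⟦T⟧ → Λ = ℤ_p⟦T⟧`: `μ = 0` and `λ` of the `S = 0` specialisation
# (helper file 4b, the main file, for crux 2 `GoodLatticeBDPValue`, stmt-BirchSwinnertonDyer-19032, cell `bsd-eis` seat `bsd-eis-k5-c2`; RULING L13 prover half)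

THE DESCENT LEMMA of the two-variable road to [BR𝟙]/[BRω] (ky MEMO-1 R2 (v), k5-c2 MEMO-2 §5 R3,
k5-ty SPEC `RUBIN-ROAD-DRUNG-SPEC.md` §1 row «descent (v): KERNEL theorems for the prover who takes
[BR𝟙]»), as a theorem of commutative algebra — no Galois theory, no `L`-functions:

**Theorem** (`descent`, generic form; `descent_iwasawaAlgebra`, the case `A = ℤ_p⟦S⟧`).  Let
`Λ₂ = A⟦T⟧` with `A = ℤ_p⟦S⟧` (modelled as `PowerSeries (IwasawaAlgebra p)`, INNER variable `S`,
OUTER variable `T`; descent `π = PowerSeries.map PowerSeries.constantCoeff : Λ₂ →+* Λ`, `S ↦ 0`).  Let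
`Y` be a finitely generated `Λ₂`-module which EMBEDS into an elementary module
`E = Π_{i < n} Λ₂/(g_i)` with PSEUDO-NULL cokernel (this is what the structure theorem over `Λ₂`
[Bourbaki AC VII §4.4 Thm. 5] and (I2) "no non-zero pseudo-null submodule" give, see
`injective_of_isPseudoIsomorphism`), where every `g_i(S = 0) ∈ Λ` has `μ = 0` (i.e. `g_i mod (p, S)
≠ 0`; for the two-variable Selmer dual this is Hida's `μ = 0` for the anticyclotomic Katz
`L`-function, `∏ g_i` generating `char_{Λ₂}(Y) ∋ 𝓛^{(2)}`).  Let `X` be a `Λ`-module and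
`φ : Y → X` a `π`-semilinear surjection with kernel `S·Y` (i.e. `X = Y/SY = Y_{Γ⁺}` with its
`Λ`-structure).  THEN `X` is a finitely generated torsion `Λ`-module with `μ(X) = 0` and
`λ(X) = ∑_i ord(g_i mod (p, S)) = λ(∏_i g_i (S = 0))`.

PROOF.  (1) `E` is finite free over `A` of rank `n_E = ∑ ord(g_i mod 𝔪_A)` (Weierstrass preparation
over the complete local ring `A`, file `…Weierstrass`); hence `Y ↪ E` is finitely generated over `A`
and `X = φ(Y)` is finitely generated over `ℤ_p = A/(S)` — so `X` is `Λ`-finite, `Λ`-torsion and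
`μ(X) = 0` (tree `lengthAt_eq_zero_of_finite`).  (2) `C = E/Y` is pseudo-null and finite over `A`,
hence `A`-TORSION (file `…PseudoNull`, `dim A = 2`), hence `ℚ_p ⊗_{ℤ_p} C` is finite-dimensional
(`finite_baseChange_of_isTorsion`, file `…DescentPrelims`: Weierstrass division in `S` after stripping
the `p`-power part of an annihilator).  (3) Apply `ℚ_p ⊗_{ℤ_p} (·)` (flat) to `0 → Y → E → C → 0` with the endomorphism
"multiplication by `S`": `S` is injective on the free `A`-module `E`, `coker(S | ℚ_p ⊗ E) =
ℚ_p ⊗ E/SE ≅ ℚ_p^{n_E}`; the snake-lemma count (file `…Snake`) gives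
`λ(X) = dim ℚ_p ⊗ Y/SY = dim coker(S | ℚ_p ⊗ Y) = n_E`.

HONEST FRAMING.  Closes nothing by itself: it is the algebraic hinge `D` of the planned support
statement `charMainConjOnTree_of_twoVariable` (RULING L13 (S5)); the two-variable INPUTS (Rubin 1991
Thm. 4.1 two-variable main conjecture, (I2), Hida 2010 `μ = 0`, the control identifications
(i)–(iii) of ky MEMO-1 R2) are the typer's named facts / later kernel work and are NOT here.

References: Bourbaki, *Algèbre commutative* VII §4.4–4.5; Washington, *Introduction to Cyclotomic
Fields* §13.2; Skinner–Urban, *The Iwasawa main conjectures for GL₂*, Invent. Math. 195 (2014)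
§3.1; Ochiai, Ann. Inst. Fourier 55 (2005) §3; Rubin, Invent. Math. 103 (1991) §4–§5.
-/

-- the summit namespace `Summit.BirchSwinnertonDyer.BirchSwinnertonDyer` repeats the problem name by design (D-0017)
set_option linter.dupNamespace false
set_option autoImplicit false

noncomputable section

open scoped TensorProduct

open PowerSeries IsLocalRing Function Literature.NumberTheory.EllipticCurves

namespace Summit.BirchSwinnertonDyer.BirchSwinnertonDyer.Theorems.IwasawaTwoVariable

universe u v

/-! ## §1 The descent theorem (generic coefficient ring `A` with `A/(s) = ℤ_p`) -/

section Descent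

variable (p : ℕ) [Fact p.Prime]
variable {A : Type u} [CommRing A] [IsDomain A] [IsNoetherianRing A] [IsLocalRing A]
  [IsAdicComplete (maximalIdeal A) A] [Algebra ℤ_[p] A]

/-- **The descent lemma `A⟦T⟧ → ℤ_p⟦T⟧`, generic form.**  `A` is a complete Noetherian local domain of
dimension `2` with a `ℤ_p`-algebra structure, a retraction `π₀ : A → ℤ_p` with kernel `(s)`, `s ≠ 0`,
such that finitely generated TORSION `A`-modules become finite-dimensional after `ℚ_p ⊗_{ℤ_p} (·)`
(all of this holds for `A = ℤ_p⟦S⟧`, §2); `π : A⟦T⟧ → Λ` is a ring map with `π ∘ C = C ∘ π₀`.  Let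
`Y` be a finitely generated `A⟦T⟧`-module embedded (`f`, injective) into `Π_{i<n} A⟦T⟧/(g_i)` with
pseudo-null cokernel, all `g_i mod 𝔪_A ≠ 0`; let `φ : Y → X` be a `π`-semilinear surjection onto a
`Λ`-module `X` with kernel `s·Y`.  Then `X` is a finitely generated torsion `Λ`-module, `μ(X) = 0`
and `λ(X) = ∑_i ord(g_i mod 𝔪_A)`.  (Skinner–Urban 2014 §3.1 / Ochiai 2005 §3 type descent, in
`μ/λ`-currency; the cell's ky MEMO-1 R2 (v).) [folklore] -/
theorem descent (hA : ringKrullDim A = 2)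
    (π₀ : A →+* ℤ_[p]) (hπ₀ : ∀ z : ℤ_[p], π₀ (algebraMap ℤ_[p] A z) = z)
    (s : A) (hs0 : s ≠ 0) (hker : ∀ a : A, π₀ a = 0 ↔ s ∣ a)
    (hFT : ∀ (C : Type u) [AddCommGroup C] [Module A C] [Module ℤ_[p] C] [IsScalarTower ℤ_[p] A C]
      [Module.Finite A C], Module.IsTorsion A C → Module.Finite ℚ_[p] (ℚ_[p] ⊗[ℤ_[p]] C))
    (π : PowerSeries A →+* IwasawaAlgebra p)
    (hπC : ∀ a : A, π (PowerSeries.C a) = PowerSeries.C (π₀ a))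
    {Y : Type v} [AddCommGroup Y] [Module (PowerSeries A) Y] [Module.Finite (PowerSeries A) Y]
    {n : ℕ} {g : Fin n → PowerSeries A} (hg : ∀ i, (g i).map (IsLocalRing.residue A) ≠ 0)
    (f : Y →ₗ[PowerSeries A] (Π i, PowerSeries A ⧸ Ideal.span {g i})) (hf : Function.Injective f)
    (hcoker : Module.IsPseudoNull (PowerSeries A)
      ((Π i, PowerSeries A ⧸ Ideal.span {g i}) ⧸ LinearMap.range f))
    {X : Type*} [AddCommGroup X] [Module (IwasawaAlgebra p) X]
    (φ : Y →ₛₗ[π] X) (hφ : Function.Surjective φ)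
    (hφker : ∀ y, φ y = 0 ↔ ∃ y', y = (algebraMap A (PowerSeries A) s) • y') :
    Module.Finite (IwasawaAlgebra p) X ∧ Module.IsTorsion (IwasawaAlgebra p) X ∧
      muInvariant p X = 0 ∧
      lambdaInvariant p X = ∑ i, ((g i).map (IsLocalRing.residue A)).order.toNat := by
  classical
  -- scalar structures on `Y` (through `ℤ_p → A → A⟦T⟧`) and on `X` (through `ℤ_p → Λ`)
  letI : Module A Y := Module.compHom Y (algebraMap A (PowerSeries A))
  haveI : IsScalarTower A (PowerSeries A) Y := IsScalarTower.of_compHom _ _ _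
  letI : Module ℤ_[p] Y := Module.compHom Y (algebraMap ℤ_[p] (PowerSeries A))
  haveI : IsScalarTower ℤ_[p] (PowerSeries A) Y := IsScalarTower.of_compHom _ _ _
  haveI : IsScalarTower ℤ_[p] A Y := IsScalarTower.of_algebraMap_smul fun z y => by
    change (algebraMap A (PowerSeries A) (algebraMap ℤ_[p] A z)) • y =
      (algebraMap ℤ_[p] (PowerSeries A) z) • y
    rw [← IsScalarTower.algebraMap_apply]
  letI : Module ℤ_[p] X := Module.compHom X (algebraMap ℤ_[p] (IwasawaAlgebra p))
  haveI : IsScalarTower ℤ_[p] (IwasawaAlgebra p) X := IsScalarTower.of_compHom _ _ _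
  haveI : Module.Flat ℤ_[p] ℚ_[p] := IsLocalization.flat ℚ_[p] (nonZeroDivisors ℤ_[p])
  -- (1) the elementary module `E` is finite free over `A`
  haveI hEfin : Module.Finite A (Π i, PowerSeries A ⧸ Ideal.span {g i}) := finite_pi_quotient hg
  haveI hEfree : Module.Free A (Π i, PowerSeries A ⧸ Ideal.span {g i}) := free_pi_quotient hg
  have hErank := finrank_pi_quotient hg
  haveI : IsNoetherian A (Π i, PowerSeries A ⧸ Ideal.span {g i}) :=
    isNoetherian_of_isNoetherianRing_of_finite A _
  -- (2) `Y` is finite over `A`; `X` is finite over `ℤ_p`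
  haveI hYfin : Module.Finite A Y := Module.Finite.of_injective (f.restrictScalars A) hf
  have hXfinZ : Module.Finite ℤ_[p] X := by
    obtain ⟨T, hT⟩ := Module.Finite.fg_top (R := A) (M := Y)
    refine ⟨⟨T.image φ, ?_⟩⟩
    rw [eq_top_iff]
    rintro x -
    obtain ⟨y, rfl⟩ := hφ x
    have hy : y ∈ Submodule.span A (T : Set Y) := by rw [hT]; trivial
    induction hy using Submodule.span_induction with
    | mem t ht =>
      exact Submodule.subset_span (Finset.mem_coe.2 (Finset.mem_image_of_mem φ ht))
    | zero => rw [map_zero]; exact Submodule.zero_mem _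
    | add y z _ _ hy hz => rw [map_add]; exact Submodule.add_mem _ hy hz
    | smul a y _ hy =>
      have : φ (a • y) = (π₀ a) • φ y := by
        change φ ((algebraMap A (PowerSeries A) a) • y) =
          (algebraMap ℤ_[p] (IwasawaAlgebra p) (π₀ a)) • φ y
        rw [LinearMap.map_smulₛₗ, PowerSeries.algebraMap_eq, hπC, PowerSeries.algebraMap_eq]
      rw [this]
      exact Submodule.smul_mem _ _ hy
  -- (3) hence `X` is finite and torsion over `Λ` with `μ = 0`
  have hXfin : Module.Finite (IwasawaAlgebra p) X :=
    Module.Finite.of_restrictScalars_finite ℤ_[p] (IwasawaAlgebra p) X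
  have hXtors : Module.IsTorsion (IwasawaAlgebra p) X := by
    obtain ⟨q, hq, hq0⟩ := LinearMap.exists_monic_and_aeval_eq_zero ℤ_[p]
      (Algebra.lsmul ℤ_[p] ℤ_[p] X (PowerSeries.X : IwasawaAlgebra p))
    have hqX : ∀ x : X, (q : IwasawaAlgebra p) • x = 0 := fun x => by
      have := LinearMap.congr_fun hq0 x
      rwa [Polynomial.aeval_algHom_apply, Polynomial.aeval_def, PowerSeries.algebraMap_eq,
        Polynomial.eval₂_C_X_eq_coe, LinearMap.zero_apply] at this
    have hq' : (q : IwasawaAlgebra p) ≠ 0 := by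
      rw [Ne, Polynomial.coe_eq_zero_iff]
      exact hq.ne_zero
    intro x
    exact ⟨⟨q, mem_nonZeroDivisors_of_ne_zero hq'⟩, hqX x⟩
  have hXmu : muInvariant p X = 0 := (muInvariant_eq_zero_iff_finite p X hXtors).2 hXfinZ
  refine ⟨hXfin, hXtors, hXmu, ?_⟩
  -- (4) the rank count: set-up of the short exact sequence with the endomorphism `s`
  -- (`E = Π i, A⟦T⟧/(g i)`, `C = E / f(Y)`; spelled out to keep instance search syntactic)
  haveI hCfin : Module.Finite A ((Π i, PowerSeries A ⧸ Ideal.span {g i}) ⧸ LinearMap.range f) :=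
    Module.Finite.of_surjective ((LinearMap.range f).mkQ.restrictScalars A)
      (Submodule.mkQ_surjective (LinearMap.range f))
  have hCtors : Module.IsTorsion A ((Π i, PowerSeries A ⧸ Ideal.span {g i}) ⧸ LinearMap.range f) :=
    isTorsion_of_isPseudoNull hA hcoker
  haveI hVfin : Module.Finite ℚ_[p]
      (ℚ_[p] ⊗[ℤ_[p]] ((Π i, PowerSeries A ⧸ Ideal.span {g i}) ⧸ LinearMap.range f)) :=
    hFT _ hCtors
  -- the three `ℤ_p`-linear maps "multiplication by `s`"
  set sY : Y →ₗ[ℤ_[p]] Y := (LinearMap.lsmul A Y s).restrictScalars ℤ_[p] with hsY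
  set sE : (Π i, PowerSeries A ⧸ Ideal.span {g i}) →ₗ[ℤ_[p]] (Π i, PowerSeries A ⧸ Ideal.span {g i}) :=
    (LinearMap.lsmul A (Π i, PowerSeries A ⧸ Ideal.span {g i}) s).restrictScalars ℤ_[p] with hsE
  set sC : ((Π i, PowerSeries A ⧸ Ideal.span {g i}) ⧸ LinearMap.range f) →ₗ[ℤ_[p]] ((Π i, PowerSeries A ⧸ Ideal.span {g i}) ⧸ LinearMap.range f) :=
    (LinearMap.lsmul A ((Π i, PowerSeries A ⧸ Ideal.span {g i}) ⧸ LinearMap.range f) s).restrictScalars ℤ_[p] with hsC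
  set fZ : Y →ₗ[ℤ_[p]] (Π i, PowerSeries A ⧸ Ideal.span {g i}) := f.restrictScalars ℤ_[p] with hfZ
  set qZ : (Π i, PowerSeries A ⧸ Ideal.span {g i}) →ₗ[ℤ_[p]] ((Π i, PowerSeries A ⧸ Ideal.span {g i}) ⧸ LinearMap.range f) :=
    (LinearMap.range f).mkQ.restrictScalars ℤ_[p] with hqZ
  have hfq : Function.Exact fZ qZ := LinearMap.exact_map_mkQ_range f
  have hq : Function.Surjective qZ := Submodule.mkQ_surjective (LinearMap.range f)
  have hfs : fZ.comp sY = sE.comp fZ := by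
    refine LinearMap.ext fun y => ?_
    change f (s • y) = s • f y
    exact f.map_smul_of_tower s y
  have hqs : qZ.comp sE = sC.comp qZ := by
    refine LinearMap.ext fun e => ?_
    change (LinearMap.range f).mkQ (s • e) = s • (LinearMap.range f).mkQ e
    exact ((LinearMap.range f).mkQ).map_smul_of_tower s e
  have hsEinj : Function.Injective sE := by
    change Function.Injective fun e : (Π i, PowerSeries A ⧸ Ideal.span {g i}) => s • e
    exact smul_right_injective (Π i, PowerSeries A ⧸ Ideal.span {g i}) hs0
  -- base change to `ℚ_p`
  have hfq' : Function.Exact (fZ.baseChange ℚ_[p]) (qZ.baseChange ℚ_[p]) := by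
    have := Module.Flat.lTensor_exact ℚ_[p] hfq
    rwa [← LinearMap.baseChange_eq_ltensor, ← LinearMap.baseChange_eq_ltensor] at this
  have hf' : Function.Injective (fZ.baseChange ℚ_[p]) := by
    rw [LinearMap.baseChange_eq_ltensor]
    exact Module.Flat.lTensor_preserves_injective_linearMap _ hf
  have hq' : Function.Surjective (qZ.baseChange ℚ_[p]) := by
    rw [LinearMap.baseChange_eq_ltensor]
    exact LinearMap.lTensor_surjective _ hq
  have hb' : Function.Injective (sE.baseChange ℚ_[p]) := by
    rw [LinearMap.baseChange_eq_ltensor]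
    exact Module.Flat.lTensor_preserves_injective_linearMap _ hsEinj
  have hfs' : (fZ.baseChange ℚ_[p]).comp (sY.baseChange ℚ_[p]) =
      (sE.baseChange ℚ_[p]).comp (fZ.baseChange ℚ_[p]) := by
    rw [← LinearMap.baseChange_comp, hfs, LinearMap.baseChange_comp]
  have hqs' : (qZ.baseChange ℚ_[p]).comp (sE.baseChange ℚ_[p]) =
      (sC.baseChange ℚ_[p]).comp (qZ.baseChange ℚ_[p]) := by
    rw [← LinearMap.baseChange_comp, hqs, LinearMap.baseChange_comp]
  -- `coker (s | ℚ_p ⊗ E) ≅ ℚ_p ⊗ E/sE ≅ ℚ_p^{n_E}`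
  obtain ⟨eE⟩ := nonempty_quotient_smul_linearEquiv p π₀ hπ₀ s hker
    (Module.finBasisOfFinrankEq A _ hErank)
  have hEq : Function.Exact sE ((LinearMap.range sE).mkQ) := LinearMap.exact_map_mkQ_range sE
  have hEq' : Function.Exact (sE.baseChange ℚ_[p]) ((LinearMap.range sE).mkQ.baseChange ℚ_[p]) := by
    have := Module.Flat.lTensor_exact ℚ_[p] hEq
    rwa [← LinearMap.baseChange_eq_ltensor, ← LinearMap.baseChange_eq_ltensor] at this
  have hEqsurj : Function.Surjective ((LinearMap.range sE).mkQ.baseChange ℚ_[p]) := by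
    rw [LinearMap.baseChange_eq_ltensor]
    exact LinearMap.lTensor_surjective _ (Submodule.mkQ_surjective (LinearMap.range sE))
  let eW : ((ℚ_[p] ⊗[ℤ_[p]] (Π i, PowerSeries A ⧸ Ideal.span {g i})) ⧸ LinearMap.range (sE.baseChange ℚ_[p])) ≃ₗ[ℚ_[p]]
      ℚ_[p] ⊗[ℤ_[p]] (Fin (∑ i, ((g i).map (IsLocalRing.residue A)).order.toNat) → ℤ_[p]) :=
    (hEq'.linearEquivOfSurjective hEqsurj).trans (eE.baseChange ℤ_[p] ℚ_[p] _ _)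
  haveI : FiniteDimensional ℚ_[p]
      ((ℚ_[p] ⊗[ℤ_[p]] (Π i, PowerSeries A ⧸ Ideal.span {g i})) ⧸ LinearMap.range (sE.baseChange ℚ_[p])) :=
    Module.Finite.equiv eW.symm
  have hWrank : Module.finrank ℚ_[p]
      ((ℚ_[p] ⊗[ℤ_[p]] (Π i, PowerSeries A ⧸ Ideal.span {g i})) ⧸ LinearMap.range (sE.baseChange ℚ_[p])) =
      ∑ i, ((g i).map (IsLocalRing.residue A)).order.toNat := by
    rw [eW.finrank_eq, Module.finrank_baseChange, Module.finrank_fin_fun]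
  -- `coker (s | ℚ_p ⊗ Y) ≅ ℚ_p ⊗ X`
  let φZ : Y →ₗ[ℤ_[p]] X :=
    { toFun := φ
      map_add' := fun x y => map_add φ x y
      map_smul' := fun z y => by
        change φ ((algebraMap ℤ_[p] (PowerSeries A) z) • y) =
          (algebraMap ℤ_[p] (IwasawaAlgebra p) z) • φ y
        rw [LinearMap.map_smulₛₗ, IsScalarTower.algebraMap_apply ℤ_[p] A (PowerSeries A),
          PowerSeries.algebraMap_eq, hπC, hπ₀, PowerSeries.algebraMap_eq] }
  have hYq : Function.Exact sY φZ := by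
    intro y
    change φ y = 0 ↔ y ∈ Set.range sY
    rw [hφker]
    constructor
    · rintro ⟨y', rfl⟩
      exact ⟨y', rfl⟩
    · rintro ⟨y', rfl⟩
      exact ⟨y', rfl⟩
  have hYq' : Function.Exact (sY.baseChange ℚ_[p]) (φZ.baseChange ℚ_[p]) := by
    have := Module.Flat.lTensor_exact ℚ_[p] hYq
    rwa [← LinearMap.baseChange_eq_ltensor, ← LinearMap.baseChange_eq_ltensor] at this
  have hφsurj' : Function.Surjective (φZ.baseChange ℚ_[p]) := by
    rw [LinearMap.baseChange_eq_ltensor]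
    exact LinearMap.lTensor_surjective _ hφ
  let eU : ((ℚ_[p] ⊗[ℤ_[p]] Y) ⧸ LinearMap.range (sY.baseChange ℚ_[p])) ≃ₗ[ℚ_[p]]
      ℚ_[p] ⊗[ℤ_[p]] X :=
    hYq'.linearEquivOfSurjective hφsurj'
  -- the count
  obtain ⟨-, hcount⟩ := finiteDimensional_and_finrank_coker_eq_of_exact hf' hq' hfq' hfs' hqs' hb'
  change Module.finrank ℚ_[p] (ℚ_[p] ⊗[ℤ_[p]] X) = _
  rw [← eU.finrank_eq, hcount, hWrank]

end Descent

/-! ## §2 The case `A = ℤ_p⟦S⟧`: descent `Λ₂ = ℤ_p⟦S⟧⟦T⟧ → Λ = ℤ_p⟦T⟧` along `S = 0` -/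

section IwasawaAlgebra

variable (p : ℕ) [Fact p.Prime]

/-- **The descent lemma `Λ₂ = ℤ_p⟦S⟧⟦T⟧ → Λ = ℤ_p⟦T⟧` (`S ↦ 0`).**  `Λ₂ = PowerSeries (IwasawaAlgebra p)`
(inner variable `S`, outer variable `T`), `π = PowerSeries.map constantCoeff : Λ₂ → Λ`.  Let `Y` be a
finitely generated `Λ₂`-module with an injective `Λ₂`-linear map `f : Y → Π_{i<n} Λ₂/(g_i)` whose
cokernel is pseudo-null (structure theorem + (I2)), where each `g_i(S = 0) ∈ Λ` has `μ = 0`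
(`g_i(S=0) mod p ≠ 0`).  Let `φ : Y → X` be a `π`-semilinear surjection onto a `Λ`-module `X` with
kernel `S·Y` (`S` acting through the constant `C S ∈ Λ₂`).  Then `X` is finitely generated and
torsion over `Λ`, `μ(X) = 0`, and `λ(X) = ∑_i λ(g_i(S = 0))` (`λ` of a `μ = 0` series = order of its
reduction mod `p`).  All hypotheses of the generic `descent` are discharged for `ℤ_p⟦S⟧`:
`dim = 2` (tree), completeness (file 1), `A/(S) = ℤ_p` via `constantCoeff`, and the finiteness of
`ℚ_p ⊗` (torsion) (file `…DescentPrelims`).  This is ky MEMO-1 R2 (v) / k5-ty SPEC «descent (v)» as a theorem.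
[folklore] -/
theorem descent_iwasawaAlgebra
    {Y : Type v} [AddCommGroup Y] [Module (PowerSeries (IwasawaAlgebra p)) Y]
    [Module.Finite (PowerSeries (IwasawaAlgebra p)) Y]
    {n : ℕ} {g : Fin n → PowerSeries (IwasawaAlgebra p)}
    (hg : ∀ i, ((g i).map (PowerSeries.constantCoeff (R := ℤ_[p]))).map
      (IsLocalRing.residue ℤ_[p]) ≠ 0)
    (f : Y →ₗ[PowerSeries (IwasawaAlgebra p)]
      (Π i, PowerSeries (IwasawaAlgebra p) ⧸ Ideal.span {g i})) (hf : Function.Injective f)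
    (hcoker : Module.IsPseudoNull (PowerSeries (IwasawaAlgebra p))
      ((Π i, PowerSeries (IwasawaAlgebra p) ⧸ Ideal.span {g i}) ⧸ LinearMap.range f))
    {X : Type*} [AddCommGroup X] [Module (IwasawaAlgebra p) X]
    (φ : Y →ₛₗ[PowerSeries.map (PowerSeries.constantCoeff (R := ℤ_[p]))] X)
    (hφ : Function.Surjective φ)
    (hφker : ∀ y, φ y = 0 ↔
      ∃ y', y = (PowerSeries.C (PowerSeries.X : IwasawaAlgebra p) : PowerSeries (IwasawaAlgebra p)) • y') :
    Module.Finite (IwasawaAlgebra p) X ∧ Module.IsTorsion (IwasawaAlgebra p) X ∧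
      muInvariant p X = 0 ∧
      lambdaInvariant p X = ∑ i, (((g i).map (PowerSeries.constantCoeff (R := ℤ_[p]))).map
        (IsLocalRing.residue ℤ_[p])).order.toNat := by
  haveI := isAdicComplete_maximalIdeal_iwasawaAlgebra p
  have hg' : ∀ i, (g i).map (IsLocalRing.residue (IwasawaAlgebra p)) ≠ 0 :=
    fun i => (map_residue_ne_zero_iff p (g i)).2 (hg i)
  have hπ₀ : ∀ z : ℤ_[p], PowerSeries.constantCoeff (R := ℤ_[p])
      (algebraMap ℤ_[p] (IwasawaAlgebra p) z) = z := fun z => by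
    rw [PowerSeries.algebraMap_eq]
    exact PowerSeries.constantCoeff_C z
  have hker : ∀ a : IwasawaAlgebra p,
      PowerSeries.constantCoeff (R := ℤ_[p]) a = 0 ↔ (PowerSeries.X : IwasawaAlgebra p) ∣ a :=
    fun a => (PowerSeries.X_dvd_iff).symm
  have hπC : ∀ a : IwasawaAlgebra p,
      PowerSeries.map (PowerSeries.constantCoeff (R := ℤ_[p])) (PowerSeries.C a) =
        PowerSeries.C (PowerSeries.constantCoeff (R := ℤ_[p]) a) := fun a => PowerSeries.map_C _ _
  -- (the kernel hypothesis is restated inside the expected type of `descent`, whose `algebraMap`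
  -- is the constants embedding `PowerSeries.C`)
  obtain ⟨h1, h2, h3, h4⟩ := descent p (A := IwasawaAlgebra p) (IwasawaAlgebra.ringKrullDim_eq_two p)
    (PowerSeries.constantCoeff (R := ℤ_[p])) hπ₀ PowerSeries.X PowerSeries.X_ne_zero hker
    (fun C _ _ _ _ _ hC => finite_baseChange_of_isTorsion p C hC)
    (PowerSeries.map (PowerSeries.constantCoeff (R := ℤ_[p]))) hπC hg' f hf hcoker φ hφ
    (fun y => by rw [PowerSeries.algebraMap_eq]; exact hφker y)
  refine ⟨h1, h2, h3, ?_⟩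
  rw [h4]
  exact Finset.sum_congr rfl fun i _ => by rw [order_map_residue_eq p (g i)]

/-- **Descent, structure-theorem packaging.**  Same as `descent_iwasawaAlgebra`, with the embedding
hypothesis replaced by its two named sources: a PSEUDO-ISOMORPHISM `f : Y → Π_{i<n} Λ₂/(g_i)`
(structure theorem for finitely generated torsion `Λ₂`-modules, Bourbaki AC VII §4.4 Thm. 5 — `Λ₂`
is factorial, so the height-one primary components are `Λ₂/(f_i^{n_i})`) and (I2) "`Y` has no
non-zero pseudo-null submodule" (Greenberg 1978 / Perrin-Riou 1984 / Rubin 1991 Thm. 5.3 (v) for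
the two-variable Selmer dual).  [folklore] -/
theorem descent_iwasawaAlgebra_of_isPseudoIsomorphism
    {Y : Type v} [AddCommGroup Y] [Module (PowerSeries (IwasawaAlgebra p)) Y]
    [Module.Finite (PowerSeries (IwasawaAlgebra p)) Y]
    (hI2 : ∀ P : Submodule (PowerSeries (IwasawaAlgebra p)) Y,
      Module.IsPseudoNull (PowerSeries (IwasawaAlgebra p)) P → P = ⊥)
    {n : ℕ} {g : Fin n → PowerSeries (IwasawaAlgebra p)}
    (hg : ∀ i, ((g i).map (PowerSeries.constantCoeff (R := ℤ_[p]))).map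
      (IsLocalRing.residue ℤ_[p]) ≠ 0)
    (f : Y →ₗ[PowerSeries (IwasawaAlgebra p)]
      (Π i, PowerSeries (IwasawaAlgebra p) ⧸ Ideal.span {g i})) (hf : f.IsPseudoIsomorphism)
    {X : Type*} [AddCommGroup X] [Module (IwasawaAlgebra p) X]
    (φ : Y →ₛₗ[PowerSeries.map (PowerSeries.constantCoeff (R := ℤ_[p]))] X)
    (hφ : Function.Surjective φ)
    (hφker : ∀ y, φ y = 0 ↔
      ∃ y', y = (PowerSeries.C (PowerSeries.X : IwasawaAlgebra p) : PowerSeries (IwasawaAlgebra p)) • y') :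
    Module.Finite (IwasawaAlgebra p) X ∧ Module.IsTorsion (IwasawaAlgebra p) X ∧
      muInvariant p X = 0 ∧
      lambdaInvariant p X = ∑ i, (((g i).map (PowerSeries.constantCoeff (R := ℤ_[p]))).map
        (IsLocalRing.residue ℤ_[p])).order.toNat :=
  descent_iwasawaAlgebra p hg f (injective_of_isPseudoIsomorphism f hf hI2)
    (isPseudoNull_coker_of_isPseudoIsomorphism f hf) φ hφ hφker

end IwasawaAlgebra

/-! ## §3 `λ`-bookkeeping: the sum of the residual orders is the residual order of the product -/

section Orders

variable (p : ℕ) [Fact p.Prime]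

/-- `∑_i λ(g_i(S=0)) = λ((∏_i g_i)(S=0))` in residual-order form: the descent map `π = map constantCoeff`
and reduction mod `p` are ring maps and `𝔽_p⟦T⟧` is a domain, so orders add up over products
(each order being finite). Used to read the `λ` of `descent_iwasawaAlgebra` off a generator of the
characteristic ideal `(∏ g_i)`. [folklore] -/
theorem sum_toNat_order_eq_toNat_order_prod {n : ℕ} (g : Fin n → PowerSeries (IwasawaAlgebra p))
    (hg : ∀ i, ((g i).map (PowerSeries.constantCoeff (R := ℤ_[p]))).map
      (IsLocalRing.residue ℤ_[p]) ≠ 0) :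
    ∑ i, (((g i).map (PowerSeries.constantCoeff (R := ℤ_[p]))).map
        (IsLocalRing.residue ℤ_[p])).order.toNat =
      (((∏ i, g i).map (PowerSeries.constantCoeff (R := ℤ_[p]))).map
        (IsLocalRing.residue ℤ_[p])).order.toNat := by
  rw [map_prod, map_prod, PowerSeries.order_prod, ENat.toNat_sum]
  intro i _
  exact (PowerSeries.order_finite_iff_ne_zero.2 (hg i)).ne

/-- The residual order is unchanged by a unit factor: if `u` is a unit of `Λ₂` then
`ord((u g)(S=0) mod p) = ord(g(S=0) mod p)` — so the `λ` of `descent_iwasawaAlgebra` only depends on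
the ideal `(∏ g_i)` (e.g. the characteristic ideal). [folklore] -/
theorem toNat_order_mul_unit {u : PowerSeries (IwasawaAlgebra p)} (hu : IsUnit u)
    (g : PowerSeries (IwasawaAlgebra p)) :
    (((u * g).map (PowerSeries.constantCoeff (R := ℤ_[p]))).map (IsLocalRing.residue ℤ_[p])).order =
      ((g.map (PowerSeries.constantCoeff (R := ℤ_[p]))).map (IsLocalRing.residue ℤ_[p])).order := by
  rw [map_mul, map_mul, PowerSeries.order_mul]
  have hu' : IsUnit ((u.map (PowerSeries.constantCoeff (R := ℤ_[p]))).map (IsLocalRing.residue ℤ_[p])) :=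
    (hu.map _).map _
  rw [PowerSeries.order_zero_of_unit hu', zero_add]

end Orders

end Summit.BirchSwinnertonDyer.BirchSwinnertonDyer.Theorems.IwasawaTwoVariable

end
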